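import Literature.NumberTheory.Automorphic.RestrictedTensorProductIrreducibleProofs
import HarnessLib

/-!
# Discharged fact: irreducible admissible representations have a central character

`Literature.NumberTheory.Automorphic.SmoothRepresentation` records as a named fact
(`Representation.exists_hasCentralCharacter ρ : Prop`) that an irreducible admissible
representation `ρ` of a locally compact nonarchimedean group `G` on a vector space `V` over an
algebraically closed field `k` admits a central character `ω : Z(G) →* kˣ`, i.e. every central
element `z` acts as the scalar `ω z` (Schur's lemma). This file proves it
(`Representation.exists_hasCentralCharacter_holds`), so a user holding
`(h : ρ.exists_hasCentralCharacter)` can discharge the hypothesis with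
`Representation.exists_hasCentralCharacter_holds ρ`.

## Proof

A locally compact nonarchimedean group has a compact open subgroup `K`
(`Literature.NumberTheory.Automorphic.exists_isCompact_openSubgroup`: an open subgroup inside a
compact neighbourhood of `1` is closed, hence compact). For `z ∈ Z(G)` the operator `ρ z`
commutes with every `ρ g`, so by Schur's lemma for irreducible admissible representations
(`Representation.IsAdmissible.exists_eq_smul_id`, proved in
`RestrictedTensorProductIrreducibleProofs` from the finite-dimensionality of `V^{K ∩ Stab v}`)
it is a scalar `c z • id`. Since `V ≠ 0` (irreducibility) the scalar is unique, so `z ↦ c z`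
is a monoid homomorphism `Z(G) →* k`, which lifts to `Z(G) →* kˣ` because `Z(G)` is a group
(`MonoidHom.toHomUnits`). As on the vendored fact, no countability hypothesis on `G` is needed
under admissibility.

## Main results

* `Literature.NumberTheory.Automorphic.exists_isCompact_openSubgroup`: a locally compact
  nonarchimedean group has a compact open subgroup.
* `Representation.IsAdmissible.exists_apply_center_eq_smul_id`: central elements act by scalars
  on an irreducible admissible representation.
* `Representation.exists_hasCentralCharacter_holds`: the discharge.

## References

* I. N. Bernstein, A. V. Zelevinsky, *Representations of the group `GL(n, F)` where `F` is a
  non-archimedean local field*, Russian Math. Surveys 31:3 (1976), 1–68, 2.11 (Schur's lemma and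
  the central character). doi:10.1070/RM1976v031n03ABEH001532 [BernsteinZelevinskyRMS1976]
  (not held at the time of writing; numbering as recorded on the vendored fact).
* D. Bump, *Automorphic Forms and Representations*, Cambridge Stud. Adv. Math. 55 (1997), §4.2:
  Proposition 4.2.1 (p. 423: compact open subgroups form a neighbourhood base in a totally
  disconnected locally compact group), Proposition 4.2.4 (p. 428: Schur's lemma for irreducible
  admissible representations, over `ℂ`) and the remark following it (p. 428: "the center of `G`
  acts by scalars on the irreducible admissible representation", whence the central
  quasicharacter). Page numbers are those of the held PDF. [Bump1997]
* C. J. Bushnell, G. Henniart, *The local Langlands conjecture for `GL(2)`* (2006), §2.6,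
  Corollary 1.
-/

namespace Literature.NumberTheory.Automorphic

/-- A locally compact nonarchimedean topological group has a compact open subgroup: by local
compactness `1` has a compact neighbourhood `N`, by the nonarchimedean property `N` contains an
open subgroup `K`, and an open subgroup is closed (`Subgroup.isClosed_of_isOpen`), hence compact
as a closed subset of `N`. (A weak form of Bump 1997, Proposition 4.2.1, p. 423, which gives a
neighbourhood base of compact open subgroups for totally disconnected locally compact `G`;
Bushnell–Henniart §1.1.) [folklore] -/
theorem exists_isCompact_openSubgroup {G : Type*} [Group G] [TopologicalSpace G]
    [NonarchimedeanGroup G] [LocallyCompactSpace G] :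
    ∃ K : OpenSubgroup G, IsCompact (K : Set G) := by
  obtain ⟨N, hNc, hN⟩ := exists_compact_mem_nhds (1 : G)
  obtain ⟨K, hK⟩ := NonarchimedeanGroup.is_nonarchimedean N hN
  exact ⟨K, hNc.of_isClosed_subset ((K : Subgroup G).isClosed_of_isOpen K.isOpen) hK⟩

end Literature.NumberTheory.Automorphic

namespace Representation

open Literature.NumberTheory.Automorphic

variable {k G V : Type*} [Field k] [Group G] [TopologicalSpace G] [AddCommGroup V] [Module k V]

/-- **Central elements act by scalars.** If `ρ` is an irreducible admissible representation of a
locally compact nonarchimedean group over an algebraically closed field, then every `z ∈ Z(G)`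
acts as a scalar: `ρ z` is an intertwiner (`ρ z ∘ ρ g = ρ (z g) = ρ (g z) = ρ g ∘ ρ z`), so
Schur's lemma `Representation.IsAdmissible.exists_eq_smul_id` applies with any compact open
subgroup (`exists_isCompact_openSubgroup`).
(Bump 1997, Proposition 4.2.4 and the remark following it, p. 428; Bernstein–Zelevinsky 1976,
2.11; Bushnell–Henniart §2.6, Corollary 1.) [cite: Bump1997, Proposition 4.2.4 and remark, p. 428] -/
theorem IsAdmissible.exists_apply_center_eq_smul_id [IsAlgClosed k] [NonarchimedeanGroup G]
    [LocallyCompactSpace G] {ρ : Representation k G V} [ρ.IsIrreducible] (hρ : ρ.IsAdmissible)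
    (z : Subgroup.center G) :
    ∃ c : k, ρ (z : G) = c • (LinearMap.id : V →ₗ[k] V) := by
  obtain ⟨K, hKc⟩ := exists_isCompact_openSubgroup (G := G)
  refine hρ.exists_eq_smul_id K.isOpen hKc (ρ (z : G)) fun g => ?_
  rw [← Module.End.mul_eq_comp, ← Module.End.mul_eq_comp, ← map_mul, ← map_mul,
    Subgroup.mem_center_iff.1 z.2 g]

/-- **Discharge of `Representation.exists_hasCentralCharacter`** (Schur's lemma ⇒ central
character). An irreducible admissible representation `ρ` of a locally compact nonarchimedean
group over an algebraically closed field has a central character `ω : Z(G) →* kˣ` with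
`ρ z = ω z • id` for all `z ∈ Z(G)`: the scalar `c z` of
`IsAdmissible.exists_apply_center_eq_smul_id` is unique because `V ≠ 0`, hence multiplicative
in `z`, and the monoid homomorphism `z ↦ c z` lifts to units since `Z(G)` is a group.
(Bump 1997, remark after Proposition 4.2.4, p. 428; Bernstein–Zelevinsky 1976, 2.11;
Bushnell–Henniart §2.6, Corollary 1.) [cite: Bump1997, remark after Proposition 4.2.4, p. 428] -/
theorem exists_hasCentralCharacter_holds (ρ : Representation k G V) :
    ρ.exists_hasCentralCharacter := by
  intro _ _ _ _ hρ
  choose c hc using fun z : Subgroup.center G => hρ.exists_apply_center_eq_smul_id z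
  have hc' : ∀ (z : Subgroup.center G) (v : V), ρ (z : G) v = c z • v := fun z v => by
    rw [hc z]; rfl
  haveI : Nontrivial V := IsIrreducible.nontrivial ρ
  obtain ⟨v₀, hv₀⟩ := exists_ne (0 : V)
  have huniq : ∀ {a b : k}, a • v₀ = b • v₀ → a = b := fun {a b} h => by
    rw [← sub_eq_zero, ← sub_smul] at h
    exact sub_eq_zero.1 ((smul_eq_zero.1 h).resolve_right hv₀)
  let ω : Subgroup.center G →* k :=
    { toFun := c
      map_one' := huniq <| by rw [← hc' 1, OneMemClass.coe_one, map_one, one_smul]; rfl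
      map_mul' := fun z w => huniq <| by
        rw [← hc' (z * w), Subgroup.coe_mul, map_mul, Module.End.mul_apply, hc' w, map_smul,
          hc' z, smul_smul, mul_comm] }
  refine ⟨ω.toHomUnits, fun z => ?_⟩
  rw [MonoidHom.coe_toHomUnits]
  exact hc z

end Representation
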